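import Mathlib

/-!
# Dimock, *The renormalization group according to Balaban* III, App. C "a bound below", Lemma 20
(`\label{sylvan1}`, cited there to [Bal83b] = Bałaban CMP 89) — PROVED for an arbitrary finite union `X` of unit blocks,
every dimension, with an explicit constant

**Citation header (reproduction of PUBLISHED work; template of the Balaban lattice Yang–Mills cell).**
J. Dimock, *The renormalization group according to Balaban III. Convergence*, Ann. Henri Poincaré **15** (2014)
2133–2175 (= arXiv:1304.0705v1) [Dimock2013BalabanIII], Appendix C "a bound below", Lemma 20 with its proof.  TeX line
numbers refer to the arXiv source held by the cell (`inputs/files/dimock/src/1304.0705/1304.0705.tex`, 2836 lines,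
sha256[:16] dfd556282834aeba), L2663–2725.  Lattice conventions: J. Dimock, *… I. Small fields*, Rev. Math. Phys. **25**
(2013) 1330010 (= arXiv:1108.1335v2) [Dimock2013], (three0) L206–208, (lattice1) L212–214, L317–327 and L439–443.

**What the paper prints (verbatim).**  L2665–2667: *"Let Φ : 𝕋⁰_{𝖭+𝖬−k} → ℝ and φ : 𝕋^{−k}_{𝖭+𝖬−k} → ℝ, and let X be
a union of unit blocks in 𝕋^{−k}_{𝖭+𝖬−k}.  For the following result we employ Neumann boundary conditions: only bonds
contained in X contribute."*  **Lemma 20** (L2670–2676): *"There is a constant c₀ = 𝒪(1) such that for 0 ≤ μ ≤ 1*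
  *½ ‖Φ − Q_k φ‖²_X + ½ ‖∂φ‖²_X + ½ μ ‖φ‖²_X ≥ c₀ ( ‖∂Φ‖²_X + μ ‖Φ‖²_X )."*
PROOF as printed.  L2680–2688: *"We have for y ∈ X ∩ 𝕋⁰_{𝖭+𝖬−k}  |Φ(y)| ≤ |Φ(y) − (Q_k φ)(y)| + |(Q_k φ)(y)|  which yields
‖Φ‖_X ≤ ‖Φ − Q_k φ‖_X + ‖Q_k φ‖_X and hence  ‖Φ‖²_X ≤ 2( ‖Φ − Q_k φ‖²_X + ‖φ‖²_X ).  This gives half the result."*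
L2698–2705 (swoon): *"We also need a bound on ‖∂Φ‖²_X.  For a bond <y, y + e_μ> in X ∩ 𝕋⁰_{𝖭+𝖬−k}
|∂_μΦ(y)| = |Φ(y + e_μ) − Φ(y)| ≤ |Φ(y + e_μ) − (Q_k φ)(y + e_μ)| + |(Q_k φ)(y + e_μ) − (Q_k φ)(y)| + |(Q_k φ)(y) − Φ(y)|"*;
L2706–2715: *"The middle term is written as (Q_k φ)(y + e_μ) − (Q_k φ)(y) = ∫_{Δ_y} dx (φ(x + e_μ) − φ(x))
= ∫₀¹ dz ∫_{Δ_y} dx (∂_μφ)(x + z e_μ) where Δ_y the unit cube centered on y and z ∈ L^{−k}ℤ.  Therefore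
|(Q_k φ)(y + e_μ) − (Q_k φ)(y)| ≤ ∫₀¹ dz ‖∂_μφ(· + z e_μ)‖_{Δ_y} ≤ ‖∂_μ φ‖_{Δ_y ∪ (Δ_y + e_μ)}"*; L2716–2720: *"This leads to
Σ_{<y, y+e_μ> ∈ X} |(Q_k φ)(y + e_μ) − (Q_k φ)(y)|² ≤ Σ_{<y, y+e_μ> ∈ X} ‖∂φ‖²_{Δ_y ∪ (Δ_y + e_μ)} ≤ 2 ‖∂φ‖²_X"*;
L2721–2725: *"Using this in (swoon) yields ‖∂Φ‖²_X ≤ 𝒪(1)( ‖Φ − Q_k φ‖²_X + ‖∂φ‖²_X ) to complete the proof."*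
Conventions of [Dimock2013] in force: (three0) *"<u,v> = ∫ u(x)v(x) dx ≡ L^{−3𝖭} Σ_{x ∈ 𝕋^{−𝖭}_𝖬} u(x)v(x)"*, (lattice1)
*"(∂_μ φ)(x) = (φ(x + L^{−𝖭}e_μ) − φ(x))/L^{−𝖭}"*, L442 *"(Q_k f)(y) = L^{−3k} Σ_{x ∈ B_k(y)} f(x) = ∫_{|x−y|<1/2} f(x) dx"*
with (L439–441) *"cubes B_k(y) with L^{3k} sites (L^k on a side)"*; on the unit lattice 𝕋⁰ the sums are unweighted.

**What is reproduced here (kernel-checked, zero `sorry`), and on which carrier.**  The TWO-SCALE INDEX MODEL of the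
cell (the same model as pv17's `Balaban1983to89.B4BoxCov237` §4, there on BOXES): dimension `d` (Dimock: 3), fine
spacing `η = 1/n` with `n = L^k ≥ 1`; a fine site `x = ηz` is indexed by `z ∈ ℤ^d`, a unit site by `y ∈ ℤ^d`, the block
of `y` is `{z : ⌊z/n⌋ = y}` (`blk`), charted by `chart n y j = n·y + j`, `j ∈ {0,…,n−1}^d` (`blk_chart`, `chart_blk`).
`X` is ANY finite set of unit sites (its fine sites `fine n X` = the blocks over `X`, `mem_fine`).  Norms restricted to
`X` with Neumann bonds exactly as printed: `cNorm X Φ = Σ_{y∈X} Φ(y)²`, `cDir X Φ = Σ_μ Σ_{y, y+e_μ ∈ X} (Φ(y+e_μ) − Φ(y))²`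
(= ‖∂Φ‖²_X), `fNorm n X φ = Σ_{z ∈ fine X} η^d φ(z)²` (= ‖φ‖²_X by (three0)), `fDir n X φ = Σ_μ Σ_{z, z+e_μ ∈ fine X}
η^{d−2}(φ(z+e_μ) − φ(z))²` (= ‖∂φ‖²_X by (three0)+(lattice1): `η^d·((φ(x+ηe_μ) − φ(x))/η)²`), and
`Q n φ y = η^d Σ_j φ(chart n y j)` (= (Q_k φ)(y), L442).  PROVED:
* §2 (half the result) `cNorm_le_two_mul` (the printed `‖Φ‖² ≤ 2(‖Φ − Ψ‖² + ‖Ψ‖²)`), `cNorm_Q_le` (`‖Q_kφ‖²_X ≤ ‖φ‖²_X`,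
  the step *"‖Q_k φ‖_X ≤ ‖φ‖_X"* used silently at L2684–2686: Cauchy–Schwarz on each block);
* §3 (the middle term) `Q_sub_Q_eq_sum` (the printed telescoping L2706–2710 on the lattice: `(Q_kφ)(y+e_μ) − (Q_kφ)(y)
  = η^d Σ_j Σ_{t<n} (φ(z_{j,t} + e_μ) − φ(z_{j,t}))`, `z_{j,t} = chart n y j + t e_μ`), `Q_sub_Q_sq_le` (L2711–2715 squared:
  `|(Q_kφ)(y+e_μ) − (Q_kφ)(y)|² ≤ ‖∂_μφ‖²_{Δ_y ∪ (Δ_y+e_μ)}` — Cauchy–Schwarz, then each fine bond is hit by at most `n`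
  of the `n^d·n` paths: `card_fiber_path_le`), `sum_near_le_two_mul` (L2716–2720: each fine bond lies in
  `Δ_y ∪ (Δ_y + e_μ)` for at most two unit bonds `<y, y+e_μ>` — `card_filter_near_le`);
* §4 (swoon, summed) `cDir_le`: `‖∂Φ‖²_X ≤ 6d ‖Φ − Q_kφ‖²_X + 6 ‖∂φ‖²_X` (the printed `𝒪(1)` made explicit: `(a+b+c)² ≤
  3(a²+b²+c²)`, each unit site is the upper/lower end of ≤ d bonds of X, and §3);
* §5 **LEMMA 20**: `bound_below_explicit` (`‖∂Φ‖²_X + μ‖Φ‖²_X ≤ (6d+2)‖Φ − Q_kφ‖²_X + 6‖∂φ‖²_X + 2μ‖φ‖²_X` for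
  `0 ≤ μ ≤ 1`), the PRINTED SHAPE `bound_below` with `c₀ = 1/(12d + 4)` for every `d ≥ 1`, and `bound_below_three`
  (`d = 3`, `c₀ = 1/40`).

**Deviations from the print (declared).**  (i) Carrier: the ℤ^d index model in place of the toroidal lattice
𝕋^{−k}_{𝖭+𝖬−k}; since only bonds INSIDE the finite set X contribute (Neumann), the torus enters only if X wraps around
the torus, a case not treated here.  (ii) Dimock's cubes are CENTRED (*"|x − y| < 1/2"*, L odd, [Dimock2013] L322–327);
the chart uses the half-open blocks `n·y + {0,…,n−1}^d` — a relabelling of the fine sites inside each block, immaterial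
to every statement (what is used: each block has `n^d` sites and `block(y) + n e_μ = block(y + e_μ)`, `chart_add_e`).
(iii) `X` need not be a union of `M`-cubes nor connected: any finite set of unit blocks.  (iv) The constant: the print
has `c₀ = 𝒪(1)`; the printed route gives `c₀ = 1/(12d+4)` (recorded, not optimised).  (v) `∫₀¹ dz … (∂_μφ)(x + z e_μ)`
(L2708–2710) is the lattice telescoping sum over the `n` fine steps `t = 0,…,n−1` (`telescope`).

**What is NOT claimed.**  Nothing about [Bal83b] = [Balaban1983Regularity] itself (the Bałaban-side box statements are
pv17's `B4BoxCov237.dirBox_blockAvg_le` / `Keff_form_ge`; TEMPLATE.md §13 row T01.3 grades the correspondence); nothing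
about the uses of Lemma 20 in [Dimock2013BalabanIII] §3.3 (L1845, L1954 (lowerbound): the small-factor extraction of
Lemma 13 on `□^{∼R₁}`), which involve the fields `φ_{j,Ω(…)}` and the action `Ŝ_j`; no operator (Schur-complement) form
of the bound.  Elementary real analysis (finite sums, Cauchy–Schwarz) on the index model; the index-model API and
the counting helpers are `private` and tagged `[folklore]`; every public declaration carries its `[cite: …]` locator.  NOT summit progress; NOT a statement about any Bałaban paper; NOT continuum; NOT Clay.
Unit `b2b-balaban-template` gen 28 (journal CLAIM D3-APPC-BOUND-BELOW-KERNEL).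
-/

namespace Literature.MathematicalPhysics.QuantumFieldTheory.Dimock2011to13.BoundBelow

open Finset

variable {d : ℕ}

/-! ## §1 The two-scale index model: unit vectors, blocks, charts, fine sites over `X` -/

/-- the unit vector `e_μ ∈ ℤ^d` ([Dimock2013] L210: *"oriented unit basis vectors"*). [folklore] -/
def e (μ : Fin d) : Fin d → ℤ := Pi.single μ 1

/-- `e_μ(μ) = 1`. [folklore] -/
@[simp] private theorem e_apply_same (μ : Fin d) : e μ μ = 1 := by simp [e]

/-- `e_μ(ν) = 0` for `ν ≠ μ`. [folklore] -/
@[simp] private theorem e_apply_ne {μ ν : Fin d} (h : ν ≠ μ) : e μ ν = 0 := by simp [e, h]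

/-- the block label of a fine site: `⌊z/n⌋` coordinatewise (the unit site `y` with `ηz ∈ Δ_y`). [folklore] -/
def blk (n : ℕ) (z : Fin d → ℤ) : Fin d → ℤ := fun i => z i / (n : ℤ)

/-- the chart of the block over `y`: `chart n y j = n·y + j`, `j ∈ {0,…,n−1}^d` (the `L^{dk}` sites of `B_k(y)`,
[Dimock2013] L439–441, up to the relabelling (ii) of the header). [folklore] -/
def chart (n : ℕ) (y : Fin d → ℤ) (j : Fin d → Fin n) : Fin d → ℤ :=
  fun i => (n : ℤ) * y i + ((j i : ℕ) : ℤ)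

/-- coordinates of a chart point. [folklore] -/
private theorem chart_apply (n : ℕ) (y : Fin d → ℤ) (j : Fin d → Fin n) (i : Fin d) :
    chart n y j i = (n : ℤ) * y i + ((j i : ℕ) : ℤ) := rfl

/-- a chart point of the block over `y` has block label `y`. [folklore] -/
private theorem blk_chart {n : ℕ} (hn : 0 < n) (y : Fin d → ℤ) (j : Fin d → Fin n) : blk n (chart n y j) = y := by
  funext i
  have hn' : (n : ℤ) ≠ 0 := by exact_mod_cast hn.ne'
  have h0 : (0 : ℤ) ≤ ((j i : ℕ) : ℤ) := by positivity
  have h1 : ((j i : ℕ) : ℤ) < n := by exact_mod_cast (j i).isLt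
  simp only [blk, chart_apply]
  rw [add_comm, Int.add_mul_ediv_left _ _ hn', Int.ediv_eq_zero_of_lt h0 h1, zero_add]

/-- the chart of a block is injective. [folklore] -/
private theorem chart_injective (n : ℕ) (y : Fin d → ℤ) : Function.Injective (chart n y) := by
  intro j j' h
  funext i
  have hi := congrFun h i
  rw [chart_apply, chart_apply] at hi
  exact Fin.ext (by exact_mod_cast (add_left_cancel hi))

/-- the chart is injective in the pair (block label, offset). [folklore] -/
private theorem chart_pair_injective {n : ℕ} (hn : 0 < n) :
    Function.Injective (fun p : (Fin d → ℤ) × (Fin d → Fin n) => chart n p.1 p.2) := by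
  rintro ⟨y, j⟩ ⟨y', j'⟩ h
  have hy : y = y' := by
    have h2 := congrArg (blk n) h
    simpa only [blk_chart hn] using h2
  subst hy
  have hj : j = j' := chart_injective n y h
  rw [hj]

/-- every fine site is a chart point of its own block. [folklore] -/
private theorem chart_blk {n : ℕ} (hn : 0 < n) (z : Fin d → ℤ) : ∃ j : Fin d → Fin n, chart n (blk n z) j = z := by
  have hn0 : (0 : ℤ) < n := by exact_mod_cast hn
  have hn' : (n : ℤ) ≠ 0 := hn0.ne'
  have h0 : ∀ i, 0 ≤ z i % (n : ℤ) := fun i => Int.emod_nonneg _ hn'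
  have h1 : ∀ i, z i % (n : ℤ) < n := fun i => Int.emod_lt_of_pos _ hn0
  refine ⟨fun i => ⟨(z i % (n : ℤ)).toNat, (Int.toNat_lt (h0 i)).2 (h1 i)⟩, ?_⟩
  funext i
  rw [chart_apply]
  simp only [blk]
  rw [Int.toNat_of_nonneg (h0 i)]
  exact Int.mul_ediv_add_emod (z i) n

/-- **THE FINE SITES OVER `X`**: the union of the blocks over the unit sites of `X` (the sites of
`X ∩ 𝕋^{−k}`, L2666 *"X be a union of unit blocks"*). [folklore] -/
def fine (n : ℕ) (X : Finset (Fin d → ℤ)) : Finset (Fin d → ℤ) :=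
  (X ×ˢ (Finset.univ : Finset (Fin d → Fin n))).image (fun p => chart n p.1 p.2)

/-- a fine site lies over `X` iff its block label is in `X`. [folklore] -/
private theorem mem_fine {n : ℕ} (hn : 0 < n) {X : Finset (Fin d → ℤ)} {z : Fin d → ℤ} :
    z ∈ fine n X ↔ blk n z ∈ X := by
  unfold fine
  rw [Finset.mem_image]
  constructor
  · rintro ⟨⟨y, j⟩, hp, rfl⟩
    rw [Finset.mem_product] at hp
    rw [blk_chart hn]
    exact hp.1
  · intro h
    obtain ⟨j, hj⟩ := chart_blk hn z
    exact ⟨(blk n z, j), Finset.mem_product.2 ⟨h, Finset.mem_univ _⟩, hj⟩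

/-- **SUMS OVER THE FINE SITES OF `X` THROUGH THE CHARTS**: `Σ_{z ∈ X ∩ 𝕋^{−k}} f(z) = Σ_{y ∈ X} Σ_j f(n·y + j)`.
[folklore] -/
private theorem sum_fine {n : ℕ} (hn : 0 < n) (X : Finset (Fin d → ℤ)) (f : (Fin d → ℤ) → ℝ) :
    ∑ z ∈ fine n X, f z = ∑ y ∈ X, ∑ j : Fin d → Fin n, f (chart n y j) := by
  unfold fine
  rw [Finset.sum_image (fun p _ q _ h => chart_pair_injective hn h), Finset.sum_product]

/-- the block of `y + e_μ` is the block of `y` shifted by `n` fine steps: `chart n (y + e_μ) j = chart n y j + n e_μ`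
(deviation (ii) of the header: this is all that is used of the block geometry). [folklore] -/
private theorem chart_add_e (n : ℕ) (y : Fin d → ℤ) (μ : Fin d) (j : Fin d → Fin n) :
    chart n (y + e μ) j = chart n y j + (n : ℤ) • e μ := by
  funext i
  simp only [chart_apply, Pi.add_apply, Pi.smul_apply, smul_eq_mul]
  by_cases hi : i = μ
  · subst hi
    rw [e_apply_same]
    ring
  · rw [e_apply_ne hi]
    ring

/-- the lattice form of *"∫₀¹ dz … (∂_μφ)(x + z e_μ)"* (L2708–2710): telescoping along the `n` fine steps in
direction `μ`. [folklore] -/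
private theorem telescope (φ : (Fin d → ℤ) → ℝ) (x : Fin d → ℤ) (μ : Fin d) (n : ℕ) :
    φ (x + (n : ℤ) • e μ) - φ x
      = ∑ t ∈ Finset.range n, (φ (x + (t : ℤ) • e μ + e μ) - φ (x + (t : ℤ) • e μ)) := by
  have htel := Finset.sum_range_sub (fun t : ℕ => φ (x + (t : ℤ) • e μ)) n
  simp only [Nat.cast_zero, zero_smul, add_zero] at htel
  rw [← htel]
  refine Finset.sum_congr rfl fun t _ => ?_
  have : x + ((t + 1 : ℕ) : ℤ) • e μ = x + (t : ℤ) • e μ + e μ := by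
    push_cast
    rw [add_smul, one_smul, add_assoc]
  rw [this]

/-- `0 ≤ r < 2n ⇒ r / n ∈ {0, 1}`. [folklore] -/
private theorem ediv_eq_zero_or_one {r n : ℤ} (hn : 0 < n) (h0 : 0 ≤ r) (h2 : r < 2 * n) : r / n = 0 ∨ r / n = 1 := by
  by_cases hr : r < n
  · exact Or.inl (Int.ediv_eq_zero_of_lt h0 hr)
  · right
    have h1 : 1 ≤ r / n := by rw [Int.le_ediv_iff_mul_le hn]; linarith
    have h3 : r / n < 2 := by rw [Int.ediv_lt_iff_lt_mul hn]; linarith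
    omega

/-- coordinates of the block label of a path point `chart n y j + s e_μ`. [folklore] -/
private theorem blk_chart_add_apply {n : ℕ} (hn : 0 < n) (y : Fin d → ℤ) (j : Fin d → Fin n) (μ : Fin d) (s : ℕ)
    (i : Fin d) :
    blk n (chart n y j + (s : ℤ) • e μ) i = y i + (((j i : ℕ) : ℤ) + (s : ℤ) * e μ i) / (n : ℤ) := by
  have hn' : (n : ℤ) ≠ 0 := by exact_mod_cast hn.ne'
  simp only [blk, chart_apply, Pi.add_apply, Pi.smul_apply, smul_eq_mul]
  rw [show (n : ℤ) * y i + ((j i : ℕ) : ℤ) + (s : ℤ) * e μ i = (((j i : ℕ) : ℤ) + (s : ℤ) * e μ i) + (n : ℤ) * y i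
      by ring, Int.add_mul_ediv_left _ _ hn', add_comm]

/-- **A PATH POINT LIES IN `Δ_y ∪ (Δ_y + e_μ)`**: for `j_μ + s < 2n` the block label of `chart n y j + s e_μ` is `y` or
`y + e_μ` (the geometry behind L2713–2715 *"≤ ‖∂_μφ‖_{Δ_y ∪ (Δ_y + e_μ)}"*). [folklore] -/
private theorem blk_chart_add {n : ℕ} (hn : 0 < n) (y : Fin d → ℤ) (j : Fin d → Fin n) (μ : Fin d) {s : ℕ}
    (hs : (j μ : ℕ) + s < 2 * n) :
    blk n (chart n y j + (s : ℤ) • e μ) = y ∨ blk n (chart n y j + (s : ℤ) • e μ) = y + e μ := by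
  have key : ∀ i, i ≠ μ → blk n (chart n y j + (s : ℤ) • e μ) i = y i := by
    intro i hi
    have h0 : (0 : ℤ) ≤ ((j i : ℕ) : ℤ) := by positivity
    have h1 : ((j i : ℕ) : ℤ) < n := by exact_mod_cast (j i).isLt
    rw [blk_chart_add_apply hn, e_apply_ne hi, mul_zero, add_zero, Int.ediv_eq_zero_of_lt h0 h1, add_zero]
  have hμ : blk n (chart n y j + (s : ℤ) • e μ) μ = y μ + (((j μ : ℕ) : ℤ) + s) / (n : ℤ) := by
    rw [blk_chart_add_apply hn, e_apply_same, mul_one]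
  have hn0 : (0 : ℤ) < n := by exact_mod_cast hn
  have hs' : ((j μ : ℕ) : ℤ) + s < 2 * (n : ℤ) := by exact_mod_cast hs
  rcases ediv_eq_zero_or_one hn0 (by positivity) hs' with h | h
  · left
    funext i
    by_cases hi : i = μ
    · subst hi
      rw [hμ, h, add_zero]
    · exact key i hi
  · right
    funext i
    by_cases hi : i = μ
    · subst hi
      rw [hμ, h, Pi.add_apply, e_apply_same]
    · rw [Pi.add_apply, e_apply_ne hi, add_zero]
      exact key i hi

/-! ## §2 The norms of the lemma (restricted to `X`, Neumann bonds) and "half the result" (L2680–2688) -/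

/-- `‖Φ‖²_X = Σ_{y ∈ X ∩ 𝕋⁰} Φ(y)²` (unit lattice, unweighted). [cite: Dimock2013BalabanIII, App. C L2665–2676
(arXiv:1304.0705v1 TeX); Dimock2013 (three0)] -/
def cNorm (X : Finset (Fin d → ℤ)) (Φ : (Fin d → ℤ) → ℝ) : ℝ := ∑ y ∈ X, Φ y ^ 2

/-- the unit bonds `<y, y + e_μ>` contained in `X`, as the set of their lower ends (*"only bonds contained in X
contribute"*, L2667). [cite: Dimock2013BalabanIII, App. C L2667 (arXiv:1304.0705v1 TeX)] -/
def cBonds (X : Finset (Fin d → ℤ)) (μ : Fin d) : Finset (Fin d → ℤ) := X.filter (fun y => y + e μ ∈ X)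

/-- `‖∂Φ‖²_X = Σ_μ Σ_{<y,y+e_μ> ⊂ X} (Φ(y + e_μ) − Φ(y))²` (unit lattice: `∂_μΦ(y) = Φ(y+e_μ) − Φ(y)`, L2702).
[cite: Dimock2013BalabanIII, App. C (swoon) L2700–2705 (arXiv:1304.0705v1 TeX)] -/
def cDir (X : Finset (Fin d → ℤ)) (Φ : (Fin d → ℤ) → ℝ) : ℝ :=
  ∑ μ, ∑ y ∈ cBonds X μ, (Φ (y + e μ) - Φ y) ^ 2

/-- the volume of a fine site: `η^d = n^{−d}` (`L^{−3k}`, (three0)). [folklore] -/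
noncomputable def wt (d n : ℕ) : ℝ := ((n : ℝ) ^ d)⁻¹

/-- `η^d > 0`. [folklore] -/
private theorem wt_pos (d : ℕ) {n : ℕ} (hn : 0 < n) : 0 < wt d n := by
  unfold wt
  have : (0 : ℝ) < n := by exact_mod_cast hn
  positivity

/-- `η^d · n^d = 1`. [folklore] -/
private theorem wt_mul_pow (d : ℕ) {n : ℕ} (hn : 0 < n) : wt d n * (n : ℝ) ^ d = 1 := by
  unfold wt
  have : (n : ℝ) ^ d ≠ 0 := by
    have : (0 : ℝ) < n := by exact_mod_cast hn
    positivity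
  field_simp

/-- `‖φ‖²_X = ∫_X φ² = η^d Σ_{z ∈ X ∩ 𝕋^{−k}} φ(z)²`. [cite: Dimock2013, (three0) L206–208 (arXiv:1108.1335v2 TeX)] -/
noncomputable def fNorm (n : ℕ) (X : Finset (Fin d → ℤ)) (φ : (Fin d → ℤ) → ℝ) : ℝ :=
  ∑ z ∈ fine n X, wt d n * φ z ^ 2

/-- the fine bonds `<z, z + e_μ>` contained in `X` (both ends over `X`), as the set of their lower ends.
[cite: Dimock2013BalabanIII, App. C L2667 (arXiv:1304.0705v1 TeX)] -/
def fBonds (n : ℕ) (X : Finset (Fin d → ℤ)) (μ : Fin d) : Finset (Fin d → ℤ) :=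
  (fine n X).filter (fun z => z + e μ ∈ fine n X)

/-- `‖∂φ‖²_X = Σ_μ ∫_{bonds of X} (∂_μφ)² = Σ_μ Σ_{<z,z+e_μ> ⊂ X} η^d ((φ(z+e_μ) − φ(z))/η)²`, `η = 1/n`.
[cite: Dimock2013, (three0) L206–208 and (lattice1) L212–214 (arXiv:1108.1335v2 TeX)] -/
noncomputable def fDir (n : ℕ) (X : Finset (Fin d → ℤ)) (φ : (Fin d → ℤ) → ℝ) : ℝ :=
  ∑ μ, ∑ z ∈ fBonds n X μ, (wt d n * (n : ℝ) ^ 2) * (φ (z + e μ) - φ z) ^ 2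

/-- **THE AVERAGING OPERATOR** `(Q_k φ)(y) = L^{−3k} Σ_{x ∈ B_k(y)} φ(x)` (here `η^d Σ_j φ(n·y + j)`).
[cite: Dimock2013, L439–443 (arXiv:1108.1335v2 TeX)] -/
noncomputable def Q (n : ℕ) (φ : (Fin d → ℤ) → ℝ) (y : Fin d → ℤ) : ℝ :=
  wt d n * ∑ j : Fin d → Fin n, φ (chart n y j)

/-- `‖Φ‖²_X ≥ 0`. [folklore] -/
private theorem cNorm_nonneg (X : Finset (Fin d → ℤ)) (Φ : (Fin d → ℤ) → ℝ) : 0 ≤ cNorm X Φ :=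
  Finset.sum_nonneg fun _ _ => sq_nonneg _

/-- `‖∂Φ‖²_X ≥ 0`. [folklore] -/
private theorem cDir_nonneg (X : Finset (Fin d → ℤ)) (Φ : (Fin d → ℤ) → ℝ) : 0 ≤ cDir X Φ :=
  Finset.sum_nonneg fun _ _ => Finset.sum_nonneg fun _ _ => sq_nonneg _

/-- `‖φ‖²_X ≥ 0`. [folklore] -/
private theorem fNorm_nonneg {n : ℕ} (hn : 0 < n) (X : Finset (Fin d → ℤ)) (φ : (Fin d → ℤ) → ℝ) : 0 ≤ fNorm n X φ :=
  Finset.sum_nonneg fun _ _ => mul_nonneg (wt_pos d hn).le (sq_nonneg _)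

/-- `‖∂φ‖²_X ≥ 0`. [folklore] -/
private theorem fDir_nonneg {n : ℕ} (hn : 0 < n) (X : Finset (Fin d → ℤ)) (φ : (Fin d → ℤ) → ℝ) : 0 ≤ fDir n X φ :=
  Finset.sum_nonneg fun _ _ => Finset.sum_nonneg fun _ _ =>
    mul_nonneg (mul_nonneg (wt_pos d hn).le (sq_nonneg _)) (sq_nonneg _)

/-- the first printed step, squared and summed: *"|Φ(y)| ≤ |Φ(y) − (Q_k φ)(y)| + |(Q_k φ)(y)| … hence
‖Φ‖²_X ≤ 2(‖Φ − Q_kφ‖²_X + ‖Q_kφ‖²_X)"* — for any comparison field `Ψ`.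
[cite: Dimock2013BalabanIII, App. C L2680–2688 (arXiv:1304.0705v1 TeX)] -/
theorem cNorm_le_two_mul (X : Finset (Fin d → ℤ)) (Φ Ψ : (Fin d → ℤ) → ℝ) :
    cNorm X Φ ≤ 2 * cNorm X (fun y => Φ y - Ψ y) + 2 * cNorm X Ψ := by
  unfold cNorm
  rw [Finset.mul_sum, Finset.mul_sum, ← Finset.sum_add_distrib]
  exact Finset.sum_le_sum fun y _ => by nlinarith [sq_nonneg (Φ y - 2 * Ψ y)]

/-- Cauchy–Schwarz on one block: `(Q_kφ)(y)² ≤ η^d Σ_{x ∈ B_k(y)} φ(x)²` (= `Q_k(φ²)(y)`). [folklore] -/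
private theorem Q_sq_le {n : ℕ} (hn : 0 < n) (φ : (Fin d → ℤ) → ℝ) (y : Fin d → ℤ) :
    Q n φ y ^ 2 ≤ wt d n * ∑ j : Fin d → Fin n, φ (chart n y j) ^ 2 := by
  unfold Q
  have hcs := sq_sum_le_card_mul_sum_sq (s := (Finset.univ : Finset (Fin d → Fin n)))
    (f := fun j => φ (chart n y j))
  have hcard : (((Finset.univ : Finset (Fin d → Fin n)).card : ℕ) : ℝ) = (n : ℝ) ^ d := by
    rw [Finset.card_univ, Fintype.card_fun, Fintype.card_fin, Fintype.card_fin]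
    push_cast
    rfl
  rw [mul_pow]
  calc wt d n ^ 2 * (∑ j, φ (chart n y j)) ^ 2
      ≤ wt d n ^ 2 * ((n : ℝ) ^ d * ∑ j, φ (chart n y j) ^ 2) := by
        refine mul_le_mul_of_nonneg_left ?_ (sq_nonneg _)
        rw [← hcard]
        exact hcs
    _ = wt d n * ∑ j, φ (chart n y j) ^ 2 := by
        rw [← mul_assoc, pow_two, mul_assoc (wt d n) (wt d n), wt_mul_pow d hn, mul_one]

/-- **`‖Q_k φ‖²_X ≤ ‖φ‖²_X`** (the averaging operator is an `L²`-contraction block by block — the step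
*"‖Φ − Q_kφ‖_X + ‖Q_kφ‖_X"* ⇒ *"2(‖Φ − Q_kφ‖²_X + ‖φ‖²_X)"* of L2684–2688).
[cite: Dimock2013BalabanIII, App. C L2684–2688 (arXiv:1304.0705v1 TeX)] -/
theorem cNorm_Q_le {n : ℕ} (hn : 0 < n) (X : Finset (Fin d → ℤ)) (φ : (Fin d → ℤ) → ℝ) :
    cNorm X (Q n φ) ≤ fNorm n X φ := by
  unfold cNorm fNorm
  rw [sum_fine hn]
  refine Finset.sum_le_sum fun y _ => ?_
  rw [← Finset.mul_sum]
  exact Q_sq_le hn φ y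

/-- **HALF THE RESULT** (L2686–2688): `‖Φ‖²_X ≤ 2(‖Φ − Q_kφ‖²_X + ‖φ‖²_X)`.
[cite: Dimock2013BalabanIII, App. C L2684–2688 (arXiv:1304.0705v1 TeX)] -/
theorem cNorm_le_half {n : ℕ} (hn : 0 < n) (X : Finset (Fin d → ℤ)) (Φ φ : (Fin d → ℤ) → ℝ) :
    cNorm X Φ ≤ 2 * (cNorm X (fun y => Φ y - Q n φ y) + fNorm n X φ) := by
  have h1 := cNorm_le_two_mul X Φ (Q n φ)
  have h2 := cNorm_Q_le hn X φ
  linarith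

/-! ## §3 The middle term of (swoon): telescoping, Cauchy–Schwarz, bond multiplicities (L2706–2720) -/

/-- the printed rewriting of the middle term on the lattice: `(Q_kφ)(y+e_μ) − (Q_kφ)(y)
= η^d Σ_j Σ_{t<n} (φ(z_{j,t} + e_μ) − φ(z_{j,t}))`, `z_{j,t} = n·y + j + t e_μ` (L2706–2710 with `∫₀¹dz ↦ Σ_t`).
[cite: Dimock2013BalabanIII, App. C L2706–2710 (arXiv:1304.0705v1 TeX)] -/
theorem Q_sub_Q_eq_sum (n : ℕ) (φ : (Fin d → ℤ) → ℝ) (y : Fin d → ℤ) (μ : Fin d) :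
    Q n φ (y + e μ) - Q n φ y
      = wt d n * ∑ j : Fin d → Fin n, ∑ t ∈ Finset.range n,
          (φ (chart n y j + (t : ℤ) • e μ + e μ) - φ (chart n y j + (t : ℤ) • e μ)) := by
  unfold Q
  rw [← mul_sub, ← Finset.sum_sub_distrib]
  congr 1
  refine Finset.sum_congr rfl fun j _ => ?_
  rw [chart_add_e, telescope]

/-- the path points `(j, t) ↦ z_{j,t} = chart n y j + t e_μ`, `t < n`, hit each fine site at most `n` times
(given `t`, the offset `j` is determined). [folklore] -/
private theorem card_fiber_path_le (n : ℕ) (y : Fin d → ℤ) (μ : Fin d) (z : Fin d → ℤ) :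
    (((Finset.univ : Finset (Fin d → Fin n)) ×ˢ Finset.range n).filter
        (fun p => chart n y p.1 + (p.2 : ℤ) • e μ = z)).card ≤ n := by
  calc (((Finset.univ : Finset (Fin d → Fin n)) ×ˢ Finset.range n).filter
          (fun p => chart n y p.1 + (p.2 : ℤ) • e μ = z)).card
      ≤ (Finset.range n).card := by
        refine Finset.card_le_card_of_injOn Prod.snd ?_ ?_
        · intro p hp
          have hp' := (Finset.mem_filter.1 (Finset.mem_coe.1 hp)).1
          exact Finset.mem_coe.2 (Finset.mem_product.1 hp').2
        · intro p hp p' hp' h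
          have h1 := (Finset.mem_filter.1 (Finset.mem_coe.1 hp)).2
          have h2 := (Finset.mem_filter.1 (Finset.mem_coe.1 hp')).2
          have h3 : chart n y p.1 = chart n y p'.1 := by
            have : chart n y p.1 + (p.2 : ℤ) • e μ = chart n y p'.1 + (p'.2 : ℤ) • e μ := by rw [h1, h2]
            rw [show p'.2 = p.2 from h.symm] at this
            exact add_right_cancel this
          exact Prod.ext (chart_injective n y h3) h
    _ = n := Finset.card_range n

/-- counting re-indexation: if `F` maps `s` into `t` with fibres of size `≤ m`, then
`Σ_{a∈s} g(F a) ≤ m Σ_{b∈t} g(b)` for `g ≥ 0`. [folklore] -/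
private theorem sum_le_mul_sum_of_fiber_le {α β : Type*} [DecidableEq β] (s : Finset α) (t : Finset β) (F : α → β)
    (hF : ∀ a ∈ s, F a ∈ t) (g : β → ℝ) (hg : ∀ b ∈ t, 0 ≤ g b) (m : ℕ)
    (hm : ∀ b ∈ t, (s.filter (fun a => F a = b)).card ≤ m) :
    ∑ a ∈ s, g (F a) ≤ m * ∑ b ∈ t, g b := by
  rw [← Finset.sum_fiberwise_of_maps_to hF (fun a => g (F a)), Finset.mul_sum]
  refine Finset.sum_le_sum fun b hb => ?_
  have hconst : ∑ a ∈ s.filter (fun a => F a = b), g (F a) = ((s.filter (fun a => F a = b)).card : ℝ) * g b := by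
    rw [Finset.sum_congr rfl (fun a ha => by rw [(Finset.mem_filter.1 ha).2] :
      ∀ a ∈ s.filter (fun a => F a = b), g (F a) = g b), Finset.sum_const, nsmul_eq_mul]
  rw [hconst]
  exact mul_le_mul_of_nonneg_right (by exact_mod_cast hm b hb) (hg b hb)

/-- the fine `μ`-bonds of `X` lying in `Δ_y ∪ (Δ_y + e_μ)` (lower end in the block of `y` or of `y + e_μ`). [folklore] -/
def near (n : ℕ) (X : Finset (Fin d → ℤ)) (μ : Fin d) (y : Fin d → ℤ) : Finset (Fin d → ℤ) :=
  (fBonds n X μ).filter (fun z => blk n z = y ∨ blk n z = y + e μ)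

/-- **THE MIDDLE TERM** (L2711–2715, squared): for a unit bond `<y, y + e_μ> ⊂ X`,
`|(Q_kφ)(y+e_μ) − (Q_kφ)(y)|² ≤ ‖∂_μφ‖²_{Δ_y ∪ (Δ_y + e_μ)} = Σ_{<z,z+e_μ> ⊂ Δ_y ∪ (Δ_y+e_μ)} η^{d−2}(φ(z+e_μ) − φ(z))²`
(Cauchy–Schwarz over the `n^d·n` summands of `Q_sub_Q_eq_sum`, then `card_fiber_path_le`).
[cite: Dimock2013BalabanIII, App. C L2711–2715 (arXiv:1304.0705v1 TeX)] -/
theorem Q_sub_Q_sq_le {n : ℕ} (hn : 0 < n) {X : Finset (Fin d → ℤ)} {y : Fin d → ℤ} {μ : Fin d}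
    (hy : y ∈ X) (hy' : y + e μ ∈ X) (φ : (Fin d → ℤ) → ℝ) :
    (Q n φ (y + e μ) - Q n φ y) ^ 2
      ≤ ∑ z ∈ near n X μ y, (wt d n * (n : ℝ) ^ 2) * (φ (z + e μ) - φ z) ^ 2 := by
  have hn0 : (0 : ℝ) < n := by exact_mod_cast hn
  -- the telescoped form, as a sum over the product index set `(j, t)`
  have heq : Q n φ (y + e μ) - Q n φ y
      = wt d n * ∑ p ∈ (Finset.univ : Finset (Fin d → Fin n)) ×ˢ Finset.range n,
          (φ (chart n y p.1 + (p.2 : ℤ) • e μ + e μ) - φ (chart n y p.1 + (p.2 : ℤ) • e μ)) := by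
    rw [Q_sub_Q_eq_sum, Finset.sum_product]
  -- Cauchy–Schwarz
  have hcard : ((((Finset.univ : Finset (Fin d → Fin n)) ×ˢ Finset.range n).card : ℕ) : ℝ) = (n : ℝ) ^ d * n := by
    rw [Finset.card_product, Finset.card_univ, Fintype.card_fun, Fintype.card_fin, Fintype.card_fin,
      Finset.card_range]
    push_cast
    rfl
  have hcs := sq_sum_le_card_mul_sum_sq (s := (Finset.univ : Finset (Fin d → Fin n)) ×ˢ Finset.range n)
    (f := fun p => φ (chart n y p.1 + (p.2 : ℤ) • e μ + e μ) - φ (chart n y p.1 + (p.2 : ℤ) • e μ))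
  rw [hcard] at hcs
  -- every path point is (the lower end of) a fine bond of `X` inside `Δ_y ∪ (Δ_y + e_μ)`
  have hmaps : ∀ p ∈ (Finset.univ : Finset (Fin d → Fin n)) ×ˢ Finset.range n,
      chart n y p.1 + (p.2 : ℤ) • e μ ∈ near n X μ y := by
    rintro ⟨j, t⟩ hp
    rw [Finset.mem_product, Finset.mem_range] at hp
    have ht : t < n := hp.2
    have hjμ : (j μ : ℕ) < n := (j μ).isLt
    have hb1 := blk_chart_add hn y j μ (s := t) (by omega)
    have hb2 := blk_chart_add hn y j μ (s := t + 1) (by omega)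
    have hstep : chart n y j + (t : ℤ) • e μ + e μ = chart n y j + ((t + 1 : ℕ) : ℤ) • e μ := by
      push_cast
      rw [add_smul, one_smul, add_assoc]
    unfold near fBonds
    rw [Finset.mem_filter, Finset.mem_filter, mem_fine hn, mem_fine hn]
    refine ⟨⟨?_, ?_⟩, hb1⟩
    · rcases hb1 with h | h
      · dsimp only
        rw [h]
        exact hy
      · dsimp only
        rw [h]
        exact hy'
    · dsimp only
      rw [hstep]
      rcases hb2 with h | h
      · rw [h]
        exact hy
      · rw [h]
        exact hy'
  -- fibres of size ≤ n
  have hfib : ∑ p ∈ (Finset.univ : Finset (Fin d → Fin n)) ×ˢ Finset.range n,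
      (φ (chart n y p.1 + (p.2 : ℤ) • e μ + e μ) - φ (chart n y p.1 + (p.2 : ℤ) • e μ)) ^ 2
        ≤ n * ∑ z ∈ near n X μ y, (φ (z + e μ) - φ z) ^ 2 :=
    sum_le_mul_sum_of_fiber_le ((Finset.univ : Finset (Fin d → Fin n)) ×ˢ Finset.range n) (near n X μ y)
      (fun p => chart n y p.1 + (p.2 : ℤ) • e μ) hmaps (fun z => (φ (z + e μ) - φ z) ^ 2)
      (fun _ _ => sq_nonneg _) n (fun z _ => card_fiber_path_le n y μ z)
  -- assemble
  rw [heq, mul_pow]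
  calc wt d n ^ 2 * (∑ p ∈ (Finset.univ : Finset (Fin d → Fin n)) ×ˢ Finset.range n,
          (φ (chart n y p.1 + (p.2 : ℤ) • e μ + e μ) - φ (chart n y p.1 + (p.2 : ℤ) • e μ))) ^ 2
      ≤ wt d n ^ 2 * ((n : ℝ) ^ d * n * ∑ p ∈ (Finset.univ : Finset (Fin d → Fin n)) ×ˢ Finset.range n,
          (φ (chart n y p.1 + (p.2 : ℤ) • e μ + e μ) - φ (chart n y p.1 + (p.2 : ℤ) • e μ)) ^ 2) :=
        mul_le_mul_of_nonneg_left hcs (sq_nonneg _)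
    _ ≤ wt d n ^ 2 * ((n : ℝ) ^ d * n * (n * ∑ z ∈ near n X μ y, (φ (z + e μ) - φ z) ^ 2)) :=
        mul_le_mul_of_nonneg_left (mul_le_mul_of_nonneg_left hfib (by positivity)) (sq_nonneg _)
    _ = (wt d n * (n : ℝ) ^ d) * ((wt d n * (n : ℝ) ^ 2) * ∑ z ∈ near n X μ y, (φ (z + e μ) - φ z) ^ 2) := by
        ring
    _ = ∑ z ∈ near n X μ y, (wt d n * (n : ℝ) ^ 2) * (φ (z + e μ) - φ z) ^ 2 := by
        rw [wt_mul_pow d hn, one_mul, Finset.mul_sum]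

/-- each fine site lies in `Δ_y ∪ (Δ_y + e_μ)` for at most two unit sites `y` (namely `⌊z/n⌋` and `⌊z/n⌋ − e_μ`).
[folklore] -/
private theorem card_filter_near_le (n : ℕ) (μ : Fin d) (S : Finset (Fin d → ℤ)) (z : Fin d → ℤ) :
    (S.filter (fun y => blk n z = y ∨ blk n z = y + e μ)).card ≤ 2 := by
  calc (S.filter (fun y => blk n z = y ∨ blk n z = y + e μ)).card
      ≤ ({blk n z, blk n z - e μ} : Finset (Fin d → ℤ)).card := by
        refine Finset.card_le_card fun y hy => ?_
        have hq := (Finset.mem_filter.1 hy).2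
        rw [Finset.mem_insert, Finset.mem_singleton]
        rcases hq with hq | hq
        · exact Or.inl hq.symm
        · right
          rw [hq, add_sub_cancel_right]
    _ ≤ 2 := Finset.card_le_two

/-- **SUMMING THE MIDDLE TERM OVER THE UNIT BONDS OF `X`** (L2716–2720): *"Σ_{<y,y+e_μ> ∈ X} ‖∂φ‖²_{Δ_y ∪ (Δ_y+e_μ)}
≤ 2‖∂φ‖²_X"* — each fine bond is counted for at most two unit bonds. Stated for any nonnegative bond weight `g`.
[cite: Dimock2013BalabanIII, App. C L2716–2720 (arXiv:1304.0705v1 TeX)] -/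
theorem sum_near_le_two_mul (n : ℕ) (X : Finset (Fin d → ℤ)) (μ : Fin d) (g : (Fin d → ℤ) → ℝ)
    (hg : ∀ z, 0 ≤ g z) :
    ∑ y ∈ cBonds X μ, ∑ z ∈ near n X μ y, g z ≤ 2 * ∑ z ∈ fBonds n X μ, g z := by
  have hrw : ∀ y, ∑ z ∈ near n X μ y, g z
      = ∑ z ∈ fBonds n X μ, (if (blk n z = y ∨ blk n z = y + e μ) then g z else 0) :=
    fun y => Finset.sum_filter _ _
  simp_rw [hrw]
  rw [Finset.sum_comm, Finset.mul_sum]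
  refine Finset.sum_le_sum fun z _ => ?_
  rw [← Finset.sum_filter, Finset.sum_const, nsmul_eq_mul]
  have hc := card_filter_near_le n μ (cBonds X μ) z
  calc (((cBonds X μ).filter (fun y => blk n z = y ∨ blk n z = y + e μ)).card : ℝ) * g z
      ≤ 2 * g z := mul_le_mul_of_nonneg_right (by exact_mod_cast hc) (hg z)

/-! ## §4 (swoon) summed over the bonds of `X` (L2698–2725) -/

/-- shifting the lower ends of the `μ`-bonds of `X` by `e_μ` lands in `X`, injectively: a sum of a nonnegative function
over the upper ends is at most the sum over `X`. [folklore] -/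
private theorem sum_cBonds_shift_le (X : Finset (Fin d → ℤ)) (μ : Fin d) (f : (Fin d → ℤ) → ℝ) (hf : ∀ y, 0 ≤ f y) :
    ∑ y ∈ cBonds X μ, f (y + e μ) ≤ ∑ y ∈ X, f y := by
  have hinj : ∀ y ∈ cBonds X μ, ∀ y' ∈ cBonds X μ, y + e μ = y' + e μ → y = y' :=
    fun y _ y' _ h => add_right_cancel h
  rw [← Finset.sum_image hinj]
  refine Finset.sum_le_sum_of_subset_of_nonneg ?_ (fun y _ _ => hf y)
  intro y' hy'
  obtain ⟨y, hy, rfl⟩ := Finset.mem_image.1 hy'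
  exact (Finset.mem_filter.1 hy).2

/-- a sum of a nonnegative function over the lower ends of the `μ`-bonds of `X` is at most the sum over `X`.
[folklore] -/
private theorem sum_cBonds_le (X : Finset (Fin d → ℤ)) (μ : Fin d) (f : (Fin d → ℤ) → ℝ) (hf : ∀ y, 0 ≤ f y) :
    ∑ y ∈ cBonds X μ, f y ≤ ∑ y ∈ X, f y := by
  unfold cBonds
  exact Finset.sum_le_sum_of_subset_of_nonneg (Finset.filter_subset _ _) (fun y _ _ => hf y)

/-- (swoon) pointwise and squared: `(Φ(y+e_μ) − Φ(y))² ≤ 3[(Φ − Q_kφ)(y+e_μ)² + ((Q_kφ)(y+e_μ) − (Q_kφ)(y))²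
+ (Φ − Q_kφ)(y)²]`. [cite: Dimock2013BalabanIII, App. C (swoon) L2698–2705 (arXiv:1304.0705v1 TeX)] -/
theorem swoon_sq (n : ℕ) (Φ φ : (Fin d → ℤ) → ℝ) (y : Fin d → ℤ) (μ : Fin d) :
    (Φ (y + e μ) - Φ y) ^ 2
      ≤ 3 * (Φ (y + e μ) - Q n φ (y + e μ)) ^ 2 + 3 * (Q n φ (y + e μ) - Q n φ y) ^ 2
        + 3 * (Φ y - Q n φ y) ^ 2 := by
  nlinarith [sq_nonneg ((Φ (y + e μ) - Q n φ (y + e μ)) - (Q n φ (y + e μ) - Q n φ y)),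
    sq_nonneg ((Q n φ (y + e μ) - Q n φ y) + (Φ y - Q n φ y)),
    sq_nonneg ((Φ (y + e μ) - Q n φ (y + e μ)) + (Φ y - Q n φ y))]

/-- **THE DERIVATIVE HALF** (L2721–2725 with the `𝒪(1)` explicit): `‖∂Φ‖²_X ≤ 6d ‖Φ − Q_kφ‖²_X + 6 ‖∂φ‖²_X`
(per direction: the two `Φ − Q_kφ` terms of (swoon) each sum to `≤ ‖Φ − Q_kφ‖²_X`, the middle terms to `≤ 2‖∂_μφ‖²_X`
by §3; then `Σ_μ`). [cite: Dimock2013BalabanIII, App. C L2716–2725 (arXiv:1304.0705v1 TeX)] -/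
theorem cDir_le {n : ℕ} (hn : 0 < n) (X : Finset (Fin d → ℤ)) (Φ φ : (Fin d → ℤ) → ℝ) :
    cDir X Φ ≤ 6 * d * cNorm X (fun y => Φ y - Q n φ y) + 6 * fDir n X φ := by
  -- per direction
  have hdir : ∀ μ : Fin d, ∑ y ∈ cBonds X μ, (Φ (y + e μ) - Φ y) ^ 2
      ≤ 6 * cNorm X (fun y => Φ y - Q n φ y)
        + 6 * ∑ z ∈ fBonds n X μ, (wt d n * (n : ℝ) ^ 2) * (φ (z + e μ) - φ z) ^ 2 := by
    intro μ
    have h1 : ∑ y ∈ cBonds X μ, (Φ (y + e μ) - Q n φ (y + e μ)) ^ 2 ≤ cNorm X (fun y => Φ y - Q n φ y) :=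
      sum_cBonds_shift_le X μ (fun y => (Φ y - Q n φ y) ^ 2) (fun _ => sq_nonneg _)
    have h3 : ∑ y ∈ cBonds X μ, (Φ y - Q n φ y) ^ 2 ≤ cNorm X (fun y => Φ y - Q n φ y) :=
      sum_cBonds_le X μ (fun y => (Φ y - Q n φ y) ^ 2) (fun _ => sq_nonneg _)
    have h2 : ∑ y ∈ cBonds X μ, (Q n φ (y + e μ) - Q n φ y) ^ 2
        ≤ 2 * ∑ z ∈ fBonds n X μ, (wt d n * (n : ℝ) ^ 2) * (φ (z + e μ) - φ z) ^ 2 := by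
      calc ∑ y ∈ cBonds X μ, (Q n φ (y + e μ) - Q n φ y) ^ 2
          ≤ ∑ y ∈ cBonds X μ, ∑ z ∈ near n X μ y, (wt d n * (n : ℝ) ^ 2) * (φ (z + e μ) - φ z) ^ 2 := by
            refine Finset.sum_le_sum fun y hy => ?_
            have hy' := Finset.mem_filter.1 hy
            exact Q_sub_Q_sq_le hn hy'.1 hy'.2 φ
        _ ≤ 2 * ∑ z ∈ fBonds n X μ, (wt d n * (n : ℝ) ^ 2) * (φ (z + e μ) - φ z) ^ 2 :=
            sum_near_le_two_mul n X μ _ (fun z => by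
              have := wt_pos d hn
              positivity)
    have h0 : ∑ y ∈ cBonds X μ, (Φ (y + e μ) - Φ y) ^ 2
        ≤ ∑ y ∈ cBonds X μ, (3 * (Φ (y + e μ) - Q n φ (y + e μ)) ^ 2 + 3 * (Q n φ (y + e μ) - Q n φ y) ^ 2
          + 3 * (Φ y - Q n φ y) ^ 2) := Finset.sum_le_sum fun y _ => swoon_sq n Φ φ y μ
    rw [Finset.sum_add_distrib, Finset.sum_add_distrib, ← Finset.mul_sum, ← Finset.mul_sum, ← Finset.mul_sum] at h0
    linarith
  unfold cDir fDir
  calc ∑ μ, ∑ y ∈ cBonds X μ, (Φ (y + e μ) - Φ y) ^ 2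
      ≤ ∑ μ : Fin d, (6 * cNorm X (fun y => Φ y - Q n φ y)
          + 6 * ∑ z ∈ fBonds n X μ, (wt d n * (n : ℝ) ^ 2) * (φ (z + e μ) - φ z) ^ 2) :=
        Finset.sum_le_sum fun μ _ => hdir μ
    _ = 6 * d * cNorm X (fun y => Φ y - Q n φ y)
          + 6 * ∑ μ, ∑ z ∈ fBonds n X μ, (wt d n * (n : ℝ) ^ 2) * (φ (z + e μ) - φ z) ^ 2 := by
        rw [Finset.sum_add_distrib, Finset.sum_const, Finset.card_univ, Fintype.card_fin, nsmul_eq_mul,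
          ← Finset.mul_sum]
        ring

/-! ## §5 Lemma 20 -/

/-- **LEMMA 20, EXPLICIT FORM**: for `0 ≤ μ ≤ 1`,
`‖∂Φ‖²_X + μ‖Φ‖²_X ≤ (6d + 2) ‖Φ − Q_kφ‖²_X + 6 ‖∂φ‖²_X + 2μ ‖φ‖²_X` (both printed halves added; `μ ≤ 1` turns
`2μ‖Φ − Q_kφ‖²_X` into `2‖Φ − Q_kφ‖²_X`). [cite: Dimock2013BalabanIII, App. C Lemma 20 (arXiv:1304.0705v1 TeX L2670–2676,
proof L2680–2725)] -/
theorem bound_below_explicit {n : ℕ} (hn : 0 < n) (X : Finset (Fin d → ℤ)) (Φ φ : (Fin d → ℤ) → ℝ) {μ : ℝ}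
    (hμ : 0 ≤ μ) (hμ1 : μ ≤ 1) :
    cDir X Φ + μ * cNorm X Φ
      ≤ (6 * d + 2) * cNorm X (fun y => Φ y - Q n φ y) + 6 * fDir n X φ + 2 * μ * fNorm n X φ := by
  have h1 := cDir_le hn X Φ φ
  have h2 := cNorm_le_half hn X Φ φ
  have hA := cNorm_nonneg X (fun y => Φ y - Q n φ y)
  have hC := fNorm_nonneg hn X φ
  have h3 : μ * cNorm X Φ ≤ 2 * μ * cNorm X (fun y => Φ y - Q n φ y) + 2 * μ * fNorm n X φ := by
    have := mul_le_mul_of_nonneg_left h2 hμ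
    linarith
  have h4 : 2 * μ * cNorm X (fun y => Φ y - Q n φ y) ≤ 2 * cNorm X (fun y => Φ y - Q n φ y) := by nlinarith
  linarith

/-- the constant of Lemma 20 made explicit by the printed route: `c₀ = 1/(12d + 4)` (`d = 3`: `1/40`). [folklore] -/
noncomputable def c0 (d : ℕ) : ℝ := 1 / (12 * d + 4)

/-- **LEMMA 20 (PRINTED SHAPE)**: *"for 0 ≤ μ ≤ 1:  ½‖Φ − Q_kφ‖²_X + ½‖∂φ‖²_X + ½μ‖φ‖²_X ≥ c₀(‖∂Φ‖²_X + μ‖Φ‖²_X)"*,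
here for every dimension `d ≥ 1`, every finite union `X` of unit blocks, Neumann bonds, with `c₀ = 1/(12d+4)`.
[cite: Dimock2013BalabanIII, App. C Lemma 20 (arXiv:1304.0705v1 TeX L2670–2676)] -/
theorem bound_below (hd : 0 < d) {n : ℕ} (hn : 0 < n) (X : Finset (Fin d → ℤ)) (Φ φ : (Fin d → ℤ) → ℝ) {μ : ℝ}
    (hμ : 0 ≤ μ) (hμ1 : μ ≤ 1) :
    c0 d * (cDir X Φ + μ * cNorm X Φ)
      ≤ (1 / 2) * cNorm X (fun y => Φ y - Q n φ y) + (1 / 2) * fDir n X φ + (1 / 2) * μ * fNorm n X φ := by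
  have h := bound_below_explicit hn X Φ φ hμ hμ1
  have hA := cNorm_nonneg X (fun y => Φ y - Q n φ y)
  have hB := fDir_nonneg hn X φ
  have hC := fNorm_nonneg hn X φ
  have hd1 : (1 : ℝ) ≤ d := by exact_mod_cast hd
  have hpos : (0 : ℝ) < 12 * d + 4 := by positivity
  unfold c0
  rw [div_mul_eq_mul_div, one_mul, div_le_iff₀ hpos]
  have hμC : 0 ≤ μ * fNorm n X φ := mul_nonneg hμ hC
  nlinarith

/-- **LEMMA 20, `d = 3`** (Dimock's lattice): `c₀ = 1/40`.
[cite: Dimock2013BalabanIII, App. C Lemma 20 (arXiv:1304.0705v1 TeX L2670–2676)] -/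
theorem bound_below_three {n : ℕ} (hn : 0 < n) (X : Finset (Fin 3 → ℤ)) (Φ φ : (Fin 3 → ℤ) → ℝ) {μ : ℝ}
    (hμ : 0 ≤ μ) (hμ1 : μ ≤ 1) :
    (1 / 40 : ℝ) * (cDir X Φ + μ * cNorm X Φ)
      ≤ (1 / 2) * cNorm X (fun y => Φ y - Q n φ y) + (1 / 2) * fDir n X φ + (1 / 2) * μ * fNorm n X φ := by
  have h := bound_below (d := 3) (by norm_num) hn X Φ φ hμ hμ1
  have hc : c0 3 = 1 / 40 := by unfold c0; norm_num
  rw [hc] at h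
  exact h

end Literature.MathematicalPhysics.QuantumFieldTheory.Dimock2011to13.BoundBelow
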